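import Literature.NumberTheory.EllipticCurves.HeathBrown1994.CongruentTwoSelmerMonskyMatrix
import Literature.NumberTheory.EllipticCurves.CongruentNumberEvenFiveSelmerBound
import Literature.NumberTheory.EllipticCurves.TwoDescentKummerBridgeDyadicCN
import HarnessLib

/-!
# Complete `2`-descent on `E_n : y² = x³ − n²x`, `n = 2p₁⋯p_k`: the local conditions on Selmer classes
# in the currency of Monsky's matrix (additive Legendre symbols)

Topic `NumberTheory/EllipticCurves`; namespace
`Literature.NumberTheory.EllipticCurves.CongruentNumberEvenMonskySelmer`. A pure proof file (theorems only);
part 1 of 2 — part 2 (`CongruentNumberEvenMonskySelmerBound.lean`) assembles these relations into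
Monsky's matrix `M = ( Aᵀ + D₂  D₋₁ ; D₂  A + D₂ )` and proves `#Sel⁽²⁾(E_n/ℚ) ≤ 2^{2+s(n)}` for every `k`
(the upper-bound half of the appendix of P. Monsky to Heath-Brown, Invent. Math. 118 (1994), even case —
the tree's named fact `HeathBrown1994.monsky_card_selmerGroup_two_even`).

For `E_n : y² = (x + n)·x·(x − n)`, `n = 2p₁⋯p_k` (`p₁, …, p_k` distinct odd primes; `e₁ = −n < e₂ = 0 < e₃ = n`),
a class `c ∈ Sel⁽²⁾(E_n/ℚ)` has components `[a]` (`T₁ = (−n, 0)`, "`x + n`") and `[b]` (`T₂ = (0, 0)`, "`x`") in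
`ℚˣ/ℚˣ²`, written `kummerEquiv ℚ 2 (twoTorsionCharH1 hT c)` / `… hT.swap₁₂ c` with representatives `a, b ∈ ℚˣ`
as in `CongruentNumberEvenFiveSelmerBound.lean` (the `k = 2` file of the same cell). Through the tree's
descent–Selmer bridge (`TwoDescentKummerBridge{Rat,AdditivePlace,RealPlace,DyadicCN}.lean`: Silverman AEC
Prop. X.1.4 / Example X.1.5 / Prop. X.4.9 on the cohomological `Sel⁽²⁾`) this file proves, uniformly in `k`:

* §1 the DICTIONARY between the descent's residue bits and Monsky's additive symbols
  (`qrBit ℓ m = addLegendreSym m ℓ`, `chi4 q = addLegendreSym (−1) q`) and quadratic reciprocity in Monsky's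
  additive form `[(q/ℓ)=−1] = [(ℓ/q)=−1] + [(−1/ℓ)=−1]·[(−1/q)=−1]` (`addLegendreSym_swap`; the off-diagonal
  entries of the appendix's display (31) `A + Aᵀ = D₋₁ + uᵀu`);
* §2 the valuations of `n`, `2n` at the `pᵢ` and off `{2, p₁, …, p_k}`;
* §3 the LOCAL CONDITIONS on a Selmer class: even valuation off `{2, p₁, …, p_k}` (`even_padicValRat_of_mem`),
  `a > 0` (`pos_of_mem`), the two `I₀*` relations at each `pᵢ` with the constants evaluated
  (`qrBit_rel_of_mem`: `qr_{pᵢ}(a) = αᵢ([2]ᵢ + A_ii) + βᵢ[2]ᵢ`, `qr_{pᵢ}(b) = αᵢ[−1]ᵢ + βᵢ([−1]ᵢ + [2]ᵢ + A_ii)`,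
  `αᵢ = v_{pᵢ}(a)`, `βᵢ = v_{pᵢ}(b) mod 2`, `A_ii = Σ_{j≠i} [(pⱼ/pᵢ)=−1]`), the `2`-adic relation
  `v₂(a) ≡ χ₄(b) + χ₄(p₁⋯p_k)·v₂(b)` (`dyadic_of_mem`), and the square-free kernel expansions
  `qr_{pᵢ}(x) = sign(x)[−1]ᵢ + [2]ᵢv₂(x) + Σ_{j≠i} [(pⱼ/pᵢ)=−1] v_{pⱼ}(x)` (`qrBit_expand`),
  `χ₄(x) = sign(x) + Σⱼ [(−1/pⱼ)=−1] v_{pⱼ}(x)` (`chi4_expand`).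

These are the printed local solubility conditions of the appendix (typescript p. 38 L24–L31, p. 41 L5–L19)
for the tree's Selmer classes. Everything is proved; no named facts; nothing about any class is booked.
Cell `bsd-monsky` (run/shared/lean/pub/bsd-monsky/, prover-B).

## References

* [HeathBrown1994SelmerCongruentII] D. R. Heath-Brown, *The size of Selmer groups for the congruent number
  problem, II*, with an appendix by P. Monsky, Invent. Math. 118 (1994) 331–370: Appendix pp. 38–42
  (the local conditions p. 38 L24–L31; `A`, `D_j`, p. 39 L10–L26; `A + Aᵀ = D₋₁ + uᵀu`, p. 39 L37–L41;
  even `D`, p. 40 L40 – p. 41 L36).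
* [SilvermanAEC2009] J. H. Silverman, *The Arithmetic of Elliptic Curves*, 2nd ed., GTM 106, Springer 2009,
  Prop. X.1.4, Example X.1.5, Prop. X.4.9.
-/

noncomputable section

open scoped Classical

open WeierstrassCurve WeierstrassCurve.Affine WeierstrassCurve.Affine.Point
open Literature.NumberTheory.GaloisRepresentations
open Literature.NumberTheory.EllipticCurves.KramerTwoDescent
open Literature.NumberTheory.EllipticCurves.TwoDescentLocal
open IsDedekindDomain NumberField Rat.HeightOneSpectrum
open Literature.NumberTheory.EllipticCurves.HeathBrown1994
open Matrix

namespace Literature.NumberTheory.EllipticCurves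

namespace CongruentNumberEvenMonskySelmer

/-! ## §1 Dictionary: the descent's residue bits are Monsky's additive Legendre symbols -/

/-- For an odd prime `ℓ ∤ m`, the residue bit `qrBit ℓ m` is Monsky's additive symbol of `(m/ℓ)`.
[cite: HeathBrown1994SelmerCongruentII, Appendix (Monsky), typescript p. 39 L10–L13] -/
theorem qrBit_intCast_eq_addLegendreSym {ℓ : ℕ} [Fact ℓ.Prime] {m : ℤ} (hm : ¬ (ℓ : ℤ) ∣ m) :
    qrBit ℓ (m : ℚ) = addLegendreSym m ℓ := by
  have h0 : (m : ZMod ℓ) ≠ 0 := by rwa [Ne, ZMod.intCast_zmod_eq_zero_iff_dvd]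
  rcases legendreSym.eq_one_or_neg_one ℓ h0 with h | h
  · rw [jacobiSym.legendreSym.to_jacobiSym] at h
    rw [qrBit_intCast_of_jacobiSym_eq_one h, addLegendreSym_of_eq_one h]
  · rw [jacobiSym.legendreSym.to_jacobiSym] at h
    rw [qrBit_intCast_of_jacobiSym_eq_neg_one h, addLegendreSym_of_eq_neg_one h]

/-- `qrBit ℓ q = [(q/ℓ) = −1]` for distinct primes `ℓ`, `q`.
[cite: HeathBrown1994SelmerCongruentII, Appendix (Monsky), typescript p. 39 L13–L22] -/
theorem qrBit_natCast_eq_addLegendreSym {ℓ q : ℕ} [Fact ℓ.Prime] (hq : q.Prime) (hℓq : ℓ ≠ q) :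
    qrBit ℓ (q : ℚ) = addLegendreSym q ℓ := by
  have h : ¬ (ℓ : ℤ) ∣ (q : ℤ) := fun hd =>
    hℓq ((Nat.prime_dvd_prime_iff_eq (Fact.out : ℓ.Prime) hq).mp (Int.natCast_dvd_natCast.mp hd))
  exact_mod_cast qrBit_intCast_eq_addLegendreSym h

/-- `qrBit ℓ 2 = [(2/ℓ) = −1]` for an odd prime `ℓ`.
[cite: HeathBrown1994SelmerCongruentII, Appendix (Monsky), typescript p. 39 L10–L13] -/
theorem qrBit_two_eq_addLegendreSym {ℓ : ℕ} [Fact ℓ.Prime] (hℓ2 : ℓ ≠ 2) :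
    qrBit ℓ (2 : ℚ) = addLegendreSym 2 ℓ := by
  have := qrBit_natCast_eq_addLegendreSym (ℓ := ℓ) Nat.prime_two hℓ2
  exact_mod_cast this

/-- `qrBit ℓ (−1) = [(−1/ℓ) = −1]` for a prime `ℓ`.
[cite: HeathBrown1994SelmerCongruentII, Appendix (Monsky), typescript p. 39 L10–L13] -/
theorem qrBit_neg_one_eq_addLegendreSym {ℓ : ℕ} [Fact ℓ.Prime] :
    qrBit ℓ (-1 : ℚ) = addLegendreSym (-1) ℓ := by
  have h : ¬ (ℓ : ℤ) ∣ (-1 : ℤ) := fun hd => by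
    have := Int.eq_one_of_dvd_one (Int.natCast_nonneg ℓ) ((Int.dvd_neg).mp hd)
    exact (Fact.out : ℓ.Prime).ne_one (by exact_mod_cast this)
  exact_mod_cast qrBit_intCast_eq_addLegendreSym h

/-- `chi4 q = [(−1/q) = −1]` for an odd prime `q` (`q ≡ 3 (mod 4)` on both sides).
[cite: HeathBrown1994SelmerCongruentII, Appendix (Monsky), typescript p. 41 L20–L26] -/
theorem chi4_natCast_eq_addLegendreSym {q : ℕ} (hq : q.Prime) (hq2 : q ≠ 2) :
    chi4 (q : ℚ) = addLegendreSym (-1) q := by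
  have hodd : q % 2 = 1 := Nat.odd_iff.mp (hq.odd_of_ne_two hq2)
  have hj : jacobiSym (-1) q = if q % 4 = 1 then 1 else -1 := by
    rw [jacobiSym.at_neg_one (Nat.odd_iff.mpr hodd), ZMod.χ₄_nat_eq_if_mod_four, if_neg (by omega)]
  rcases Nat.odd_mod_four_iff.mp hodd with h4 | h4
  · rw [chi4_eq_zero_of_eq 0 (q : ℤ) (by push_cast; ring) (by exact_mod_cast h4),
      addLegendreSym_of_eq_one (by rw [hj, if_pos h4])]
  · rw [chi4_eq_one_of_eq 0 (q : ℤ) (by push_cast; ring) (by exact_mod_cast h4),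
      addLegendreSym_of_eq_neg_one (by rw [hj, if_neg (by omega)])]

/-- **Quadratic reciprocity in Monsky's additive form**: for distinct odd primes `ℓ`, `q`,
`[(q/ℓ) = −1] = [(ℓ/q) = −1] + [(−1/ℓ) = −1]·[(−1/q) = −1]` — the off-diagonal entries of
`A + Aᵀ = D₋₁ + uᵀu` (display (31) of the appendix). [cite: HeathBrown1994SelmerCongruentII, Appendix (Monsky), typescript p. 39 L37–L41] -/
theorem addLegendreSym_swap {ℓ q : ℕ} (hℓ : ℓ.Prime) (hq : q.Prime) (hℓ2 : ℓ ≠ 2) (hq2 : q ≠ 2)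
    (hℓq : ℓ ≠ q) :
    addLegendreSym q ℓ = addLegendreSym ℓ q + addLegendreSym (-1) ℓ * addLegendreSym (-1) q := by
  have hℓo : ℓ % 2 = 1 := Nat.odd_iff.mp (hℓ.odd_of_ne_two hℓ2)
  have hqo : q % 2 = 1 := Nat.odd_iff.mp (hq.odd_of_ne_two hq2)
  have hjℓ : jacobiSym (-1) ℓ = if ℓ % 4 = 1 then 1 else -1 := by
    rw [jacobiSym.at_neg_one (Nat.odd_iff.mpr hℓo), ZMod.χ₄_nat_eq_if_mod_four, if_neg (by omega)]
  have hjq : jacobiSym (-1) q = if q % 4 = 1 then 1 else -1 := by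
    rw [jacobiSym.at_neg_one (Nat.odd_iff.mpr hqo), ZMod.χ₄_nat_eq_if_mod_four, if_neg (by omega)]
  have hgcd : (q : ℤ).gcd ℓ = 1 := by
    rw [Int.gcd_natCast_natCast]; exact (Nat.coprime_primes hq hℓ).mpr (Ne.symm hℓq)
  have hgcd' : (ℓ : ℤ).gcd q = 1 := by
    rw [Int.gcd_natCast_natCast]; exact (Nat.coprime_primes hℓ hq).mpr hℓq
  have hval := jacobiSym.eq_one_or_neg_one hgcd
  have hval' := jacobiSym.eq_one_or_neg_one hgcd'
  rcases Nat.odd_mod_four_iff.mp hℓo with h4 | h4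
  · -- `ℓ ≡ 1 (mod 4)`: `(q/ℓ) = (ℓ/q)`
    have hrec : jacobiSym (q : ℤ) ℓ = jacobiSym (ℓ : ℤ) q :=
      jacobiSym.quadratic_reciprocity_one_mod_four' (Nat.odd_iff.mpr hqo) h4
    rw [addLegendreSym_of_eq_one (a := -1) (by rw [hjℓ, if_pos h4]), zero_mul, add_zero]
    rcases hval' with h | h
    · rw [addLegendreSym_of_eq_one h, addLegendreSym_of_eq_one (hrec.trans h)]
    · rw [addLegendreSym_of_eq_neg_one h, addLegendreSym_of_eq_neg_one (hrec.trans h)]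
  · rcases Nat.odd_mod_four_iff.mp hqo with h4' | h4'
    · -- `q ≡ 1 (mod 4)`
      have hrec : jacobiSym (q : ℤ) ℓ = jacobiSym (ℓ : ℤ) q :=
        jacobiSym.quadratic_reciprocity_one_mod_four h4' (Nat.odd_iff.mpr hℓo)
      rw [addLegendreSym_of_eq_one (a := -1) (p := q) (by rw [hjq, if_pos h4']), mul_zero, add_zero]
      rcases hval' with h | h
      · rw [addLegendreSym_of_eq_one h, addLegendreSym_of_eq_one (hrec.trans h)]
      · rw [addLegendreSym_of_eq_neg_one h, addLegendreSym_of_eq_neg_one (hrec.trans h)]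
    · -- both `≡ 3 (mod 4)`: `(q/ℓ) = −(ℓ/q)`
      have hrec : jacobiSym (q : ℤ) ℓ = -jacobiSym (ℓ : ℤ) q :=
        jacobiSym.quadratic_reciprocity_three_mod_four h4' h4
      rw [addLegendreSym_of_eq_neg_one (a := -1) (p := ℓ) (by rw [hjℓ, if_neg (by omega)]),
        addLegendreSym_of_eq_neg_one (a := -1) (p := q) (by rw [hjq, if_neg (by omega)]), mul_one]
      rcases hval' with h | h
      · rw [addLegendreSym_of_eq_one h, addLegendreSym_of_eq_neg_one (by rw [hrec, h])]; decide
      · rw [addLegendreSym_of_eq_neg_one h, addLegendreSym_of_eq_one (by rw [hrec, h]; norm_num)]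
        decide

/-- `qrBit` of a finite product of non-zero rationals. [folklore] -/
private theorem qrBit_finset_prod {ℓ : ℕ} [Fact ℓ.Prime] {ι : Type*} (s : Finset ι) (f : ι → ℚ)
    (hf : ∀ i ∈ s, f i ≠ 0) : qrBit ℓ (∏ i ∈ s, f i) = ∑ i ∈ s, qrBit ℓ (f i) := by
  classical
  induction s using Finset.induction_on with
  | empty => simp [qrBit_one]
  | insert a s ha ih =>
    have hs : ∀ i ∈ s, f i ≠ 0 := fun i hi => hf i (Finset.mem_insert_of_mem hi)
    rw [Finset.prod_insert ha, Finset.sum_insert ha,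
      qrBit_mul ℓ (hf a (Finset.mem_insert_self a s)) (Finset.prod_ne_zero_iff.mpr hs), ih hs]

/-- `chi4` of a finite product of non-zero rationals. [folklore] -/
private theorem chi4_finset_prod {ι : Type*} (s : Finset ι) (f : ι → ℚ) (hf : ∀ i ∈ s, f i ≠ 0) :
    chi4 (∏ i ∈ s, f i) = ∑ i ∈ s, chi4 (f i) := by
  classical
  induction s using Finset.induction_on with
  | empty => simp [chi4_one]
  | insert a s ha ih =>
    have hs : ∀ i ∈ s, f i ≠ 0 := fun i hi => hf i (Finset.mem_insert_of_mem hi)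
    rw [Finset.prod_insert ha, Finset.sum_insert ha,
      chi4_mul (hf a (Finset.mem_insert_self a s)) (Finset.prod_ne_zero_iff.mpr hs), ih hs]

/-! ## §2 The primes `p₁, …, p_k` and `n = 2p₁⋯p_k` -/

variable {k : ℕ} {p : Fin k → ℕ}

/-- `∏ pᵢ ≠ 0` (as a rational) for primes `pᵢ`. [folklore] -/
private theorem prod_cast_ne_zero (hp : ∀ i, (p i).Prime) : (∏ i, (p i : ℚ)) ≠ 0 :=
  Finset.prod_ne_zero_iff.mpr fun i _ => Nat.cast_ne_zero.mpr (hp i).ne_zero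

/-- `2 ∏ pᵢ ≠ 0`. [folklore] -/
private theorem two_mul_prod_ne_zero (hp : ∀ i, (p i).Prime) : 2 * ∏ i, p i ≠ 0 :=
  mul_ne_zero two_ne_zero (Finset.prod_ne_zero_iff.mpr fun i _ => (hp i).ne_zero)

/-- `∏ pᵢ` is odd for odd primes `pᵢ`. [folklore] -/
private theorem odd_prod (hp : ∀ i, (p i).Prime) (hp2 : ∀ i, p i ≠ 2) : Odd (∏ i, (p i : ℤ)) :=
  Finset.prod_induction _ Odd (fun _ _ ha hb => ha.mul hb) odd_one
    fun i _ => (Int.odd_coe_nat _).mpr ((hp i).odd_of_ne_two (hp2 i))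

/-- The valuation of `∏ pⱼ` at `pᵢ` is `1`. [folklore] -/
private theorem padicValRat_prod_self (hp : ∀ i, (p i).Prime) (hinj : Function.Injective p) (i : Fin k) :
    haveI : Fact (p i).Prime := ⟨hp i⟩
    padicValRat (p i) (∏ j, (p j : ℚ)) = 1 := by
  haveI : Fact (p i).Prime := ⟨hp i⟩
  have himg : (∏ j, (p j : ℚ)) = ∏ q ∈ Finset.univ.image p, (q : ℚ) := by
    rw [Finset.prod_image fun x _ y _ h => hinj h]
  rw [himg, padicValRat_prod_primes (fun q hq => by
    obtain ⟨j, -, rfl⟩ := Finset.mem_image.mp hq; exact hp j), if_pos (Finset.mem_image_of_mem p (Finset.mem_univ i))]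

/-- The valuation of `∏ pⱼ` at a prime `r` different from every `pⱼ` is `0`. [folklore] -/
private theorem padicValRat_prod_other (hp : ∀ i, (p i).Prime) (hinj : Function.Injective p) {r : ℕ}
    (hr : r.Prime) (hrp : ∀ j, p j ≠ r) :
    haveI : Fact r.Prime := ⟨hr⟩
    padicValRat r (∏ j, (p j : ℚ)) = 0 := by
  haveI : Fact r.Prime := ⟨hr⟩
  have himg : (∏ j, (p j : ℚ)) = ∏ q ∈ Finset.univ.image p, (q : ℚ) := by
    rw [Finset.prod_image fun x _ y _ h => hinj h]
  rw [himg, padicValRat_prod_primes (fun q hq => by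
    obtain ⟨j, -, rfl⟩ := Finset.mem_image.mp hq; exact hp j), if_neg (fun h => by
      obtain ⟨j, -, hj⟩ := Finset.mem_image.mp h; exact hrp j hj)]

/-- The valuation of `2^e ∏ pⱼ` at `pᵢ` is `1`. [folklore] -/
private theorem padicValRat_two_pow_mul_prod_self (hp : ∀ i, (p i).Prime) (hp2 : ∀ i, p i ≠ 2)
    (hinj : Function.Injective p) (i : Fin k) (e : ℕ) :
    haveI : Fact (p i).Prime := ⟨hp i⟩
    padicValRat (p i) ((2 : ℚ) ^ e * ∏ j, (p j : ℚ)) = 1 := by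
  haveI : Fact (p i).Prime := ⟨hp i⟩
  haveI : Fact (Nat.Prime 2) := ⟨Nat.prime_two⟩
  rw [padicValRat.mul (pow_ne_zero _ two_ne_zero) (prod_cast_ne_zero hp), padicValRat.pow,
    show (2 : ℚ) = ((2 : ℕ) : ℚ) from rfl, padicValRat.of_nat, padicValNat_primes (hp2 i),
    padicValRat_prod_self hp hinj i]
  simp

/-- The valuation of `2^e ∏ pⱼ` at an odd prime `r` different from every `pⱼ` is `0`. [folklore] -/
private theorem padicValRat_two_pow_mul_prod_other (hp : ∀ i, (p i).Prime) (hinj : Function.Injective p)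
    {r : ℕ} (hr : r.Prime) (hr2 : r ≠ 2) (hrp : ∀ j, p j ≠ r) (e : ℕ) :
    haveI : Fact r.Prime := ⟨hr⟩
    padicValRat r ((2 : ℚ) ^ e * ∏ j, (p j : ℚ)) = 0 := by
  haveI : Fact r.Prime := ⟨hr⟩
  haveI : Fact (Nat.Prime 2) := ⟨Nat.prime_two⟩
  rw [padicValRat.mul (pow_ne_zero _ two_ne_zero) (prod_cast_ne_zero hp), padicValRat.pow,
    show (2 : ℚ) = ((2 : ℕ) : ℚ) from rfl, padicValRat.of_nat, padicValNat_primes hr2,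
    padicValRat_prod_other hp hinj hr hrp]
  simp


/-! ## §3 The local conditions on a Selmer class of `E_n : y² = (x + n) x (x − n)`, `n = 2p₁⋯p_k`
The components of `c ∈ H¹(ℚ, E_n[2])` are written `kummerEquiv ℚ 2 (twoTorsionCharH1 hT c)` (`T₁ = (−n, 0)`,
component `x + n`) and `kummerEquiv ℚ 2 (twoTorsionCharH1 hT.swap₁₂ c)` (`T₂ = (0, 0)`, component `x`),
with representatives `a, b ∈ ℚˣ`, as in `CongruentNumberEvenFiveSelmerBound.lean`. -/

/-- `qrBit pᵢ n = [(2/pᵢ) = −1] + Σ_{j ≠ i} [(pⱼ/pᵢ) = −1]` (`n = pᵢ · 2∏_{j≠i} pⱼ`).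
[cite: HeathBrown1994SelmerCongruentII, Appendix (Monsky), typescript p. 39 L10–L26] -/
theorem qrBit_n (hp : ∀ i, (p i).Prime) (hp2 : ∀ i, p i ≠ 2) (hinj : Function.Injective p) (i : Fin k) :
    haveI : Fact (p i).Prime := ⟨hp i⟩
    qrBit (p i) ((2 * ∏ i, p i : ℕ) : ℚ) =
      addLegendreSym 2 (p i) + ∑ j ∈ Finset.univ.erase i, addLegendreSym (p j) (p i) := by
  haveI : Fact (p i).Prime := ⟨hp i⟩
  have hprod : (∏ j, (p j : ℚ)) = (p i : ℚ) * ∏ j ∈ Finset.univ.erase i, (p j : ℚ) :=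
    (Finset.mul_prod_erase _ _ (Finset.mem_univ i)).symm
  have hne : ∀ j ∈ Finset.univ.erase i, (p j : ℚ) ≠ 0 := fun j _ => Nat.cast_ne_zero.mpr (hp j).ne_zero
  have hprod0 : (∏ j ∈ Finset.univ.erase i, (p j : ℚ)) ≠ 0 := Finset.prod_ne_zero_iff.mpr hne
  rw [show ((2 * ∏ i, p i : ℕ) : ℚ) = (p i : ℚ) * ((2 : ℚ) * ∏ j ∈ Finset.univ.erase i, (p j : ℚ)) by
    push_cast; rw [hprod]; ring, qrBit_natCast_mul, qrBit_mul (p i) two_ne_zero hprod0,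
    qrBit_two_eq_addLegendreSym (hp2 i), qrBit_finset_prod _ _ hne]
  congr 1
  exact Finset.sum_congr rfl fun j hj =>
    qrBit_natCast_eq_addLegendreSym (hp j) (fun h => (Finset.ne_of_mem_erase hj) (hinj h).symm)

/-- **The square-free kernel expansion at `pᵢ`** of a rational supported on `{2, p₁, …, p_k}` (up to squares):
`qrBit pᵢ x = sign(x)·[−1] + v₂(x)·[2] + Σ_{j≠i} [(pⱼ/pᵢ) = −1]·v_{pⱼ}(x)`. [cite: SilvermanAEC2009, Prop. X.1.4] -/
theorem qrBit_expand (hp : ∀ i, (p i).Prime) (hp2 : ∀ i, p i ≠ 2) (hinj : Function.Injective p) (i : Fin k)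
    {x : ℚ} (hx : x ≠ 0) (hev : ∀ r : ℕ, r.Prime → r ≠ 2 → (∀ j, p j ≠ r) → Even (padicValRat r x)) :
    haveI : Fact (p i).Prime := ⟨hp i⟩
    qrBit (p i) x = signBit x * addLegendreSym (-1) (p i) + addLegendreSym 2 (p i) * parityBit 2 x +
      ∑ j ∈ Finset.univ.erase i, addLegendreSym (p j) (p i) * parityBit (p j) x := by
  haveI : Fact (p i).Prime := ⟨hp i⟩
  set T : Finset ℕ := insert 2 ((Finset.univ.erase i).image p) with hTdef
  have hT : ∀ q ∈ T, q.Prime := by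
    intro q hq
    rcases Finset.mem_insert.mp hq with rfl | hq
    · exact Nat.prime_two
    · obtain ⟨j, -, rfl⟩ := Finset.mem_image.mp hq; exact hp j
  have h2img : (2 : ℕ) ∉ (Finset.univ.erase i).image p := fun h => by
    obtain ⟨j, -, hj⟩ := Finset.mem_image.mp h; exact hp2 j hj
  have hpT : p i ∉ T := by
    intro h
    rcases Finset.mem_insert.mp h with h | h
    · exact hp2 i h
    · obtain ⟨j, hj, hji⟩ := Finset.mem_image.mp h
      exact Finset.ne_of_mem_erase hj (hinj hji)
  have heven : ∀ q : ℕ, q.Prime → q ∉ T → q ≠ p i → Even (padicValRat q x) := by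
    intro q hq hqT hqi
    refine hev q hq (fun h => hqT (h ▸ Finset.mem_insert_self 2 _)) fun j hj => ?_
    by_cases hji : j = i
    · exact hqi (hji ▸ hj).symm
    · exact hqT (Finset.mem_insert_of_mem (Finset.mem_image.mpr ⟨j, Finset.mem_erase.mpr ⟨hji, Finset.mem_univ j⟩, hj⟩))
  rw [qrBit_eq_signBit_add_sum hx T hT hpT heven, hTdef, Finset.sum_insert h2img,
    Finset.sum_image fun x _ y _ h => hinj h, qrBit_neg_one_eq_addLegendreSym, Nat.cast_ofNat,
    qrBit_two_eq_addLegendreSym (hp2 i), mul_comm (parityBit 2 x), add_assoc]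
  congr 2
  exact Finset.sum_congr rfl fun j hj => by
    rw [qrBit_natCast_eq_addLegendreSym (hp j) (fun h => (Finset.ne_of_mem_erase hj) (hinj h).symm), mul_comm]

/-- **The square-free kernel expansion of `χ₄`**: `chi4 x = sign(x) + Σⱼ [(−1/pⱼ) = −1]·v_{pⱼ}(x)` for a rational
supported on `{2, p₁, …, p_k}` up to squares. [cite: SilvermanAEC2009, Example X.1.5] -/
theorem chi4_expand (hp : ∀ i, (p i).Prime) (hp2 : ∀ i, p i ≠ 2) (hinj : Function.Injective p)
    {x : ℚ} (hx : x ≠ 0) (hev : ∀ r : ℕ, r.Prime → r ≠ 2 → (∀ j, p j ≠ r) → Even (padicValRat r x)) :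
    chi4 x = signBit x + ∑ j, addLegendreSym (-1) (p j) * parityBit (p j) x := by
  set T : Finset ℕ := Finset.univ.image p with hTdef
  have hT : ∀ q ∈ T, q.Prime := fun q hq => by obtain ⟨j, -, rfl⟩ := Finset.mem_image.mp hq; exact hp j
  have h2T : (2 : ℕ) ∉ T := fun h => by obtain ⟨j, -, hj⟩ := Finset.mem_image.mp h; exact hp2 j hj
  have heven : ∀ q : ℕ, q.Prime → q ∉ T → q ≠ 2 → Even (padicValRat q x) := fun q hq hqT hq2 =>
    hev q hq hq2 fun j hj => hqT (Finset.mem_image.mpr ⟨j, Finset.mem_univ j, hj⟩)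
  rw [chi4_eq_signBit_add_sum hx T hT h2T heven, hTdef, Finset.sum_image fun x _ y _ h => hinj h, chi4_neg_one,
    mul_one]
  congr 1
  exact Finset.sum_congr rfl fun j _ => by rw [chi4_natCast_eq_addLegendreSym (hp j) (hp2 j), mul_comm]

/-- `chi4 (p₁⋯p_k) = Σⱼ [(−1/pⱼ) = −1]`. [cite: HeathBrown1994SelmerCongruentII, Appendix (Monsky), typescript p. 41 L20–L26] -/
theorem chi4_prod (hp : ∀ i, (p i).Prime) (hp2 : ∀ i, p i ≠ 2) :
    chi4 (((∏ j, (p j : ℤ) : ℤ)) : ℚ) = ∑ j, addLegendreSym (-1) (p j) := by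
  rw [show (((∏ j, (p j : ℤ) : ℤ)) : ℚ) = ∏ j, ((p j : ℕ) : ℚ) by push_cast; rfl,
    chi4_finset_prod _ _ fun j _ => Nat.cast_ne_zero.mpr (hp j).ne_zero]
  exact Finset.sum_congr rfl fun j _ => chi4_natCast_eq_addLegendreSym (hp j) (hp2 j)

variable [hE : (congruentNumberCurve (2 * ∏ i, p i)).IsElliptic]
variable (hT : (congruentNumberCurve (2 * ∏ i, p i)).toAffine.SplitTwoTorsion
  (-((2 * ∏ i, p i : ℕ) : ℚ)) 0 ((2 * ∏ i, p i : ℕ) : ℚ))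

/-- **Parity off `S = {2, p₁, …, p_k}`**: both components of a Selmer class of `E_n` have even valuation at
every prime `r ∉ S`. [cite: SilvermanAEC2009, Prop. X.1.4, Prop. X.4.9] -/
theorem even_padicValRat_of_mem (hp : ∀ i, (p i).Prime) (hinj : Function.Injective p)
    {c : galH1Torsion (congruentNumberCurve (2 * ∏ i, p i)) 2}
    (hc : c ∈ (congruentNumberCurve (2 * ∏ i, p i)).selmerGroup 2) (a b : ℚˣ)
    (ha : kummerEquiv ℚ 2 ((congruentNumberCurve (2 * ∏ i, p i)).twoTorsionCharH1 hT c) =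
      Additive.ofMul (QuotientGroup.mk a))
    (hb : kummerEquiv ℚ 2 ((congruentNumberCurve (2 * ∏ i, p i)).twoTorsionCharH1 hT.swap₁₂ c) =
      Additive.ofMul (QuotientGroup.mk b))
    {r : ℕ} (hr : r.Prime) (hr2 : r ≠ 2) (hrp : ∀ j, p j ≠ r) :
    haveI : Fact r.Prime := ⟨hr⟩
    Even (padicValRat r (a : ℚ)) ∧ Even (padicValRat r (b : ℚ)) := by
  haveI : Fact r.Prime := ⟨hr⟩
  set W := congruentNumberCurve (2 * ∏ i, p i) with hW
  set v : HeightOneSpectrum (𝓞 ℚ) := primesEquiv.symm ⟨r, hr⟩ with hv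
  have hrv : (primesEquiv v : ℕ) = r := by rw [hv, Equiv.apply_symm_apply]
  have h0 := padicValRat_two_pow_mul_prod_other hp hinj hr hr2 hrp
  have e12 : padicValRat r (-((2 * ∏ i, p i : ℕ) : ℚ) - 0) = 0 := by
    rw [show (-((2 * ∏ i, p i : ℕ) : ℚ)) - 0 = -((2 : ℚ) ^ 1 * ∏ j, (p j : ℚ)) by push_cast; ring,
      padicValRat.neg, h0 1]
  have e13 : padicValRat r (-((2 * ∏ i, p i : ℕ) : ℚ) - ((2 * ∏ i, p i : ℕ) : ℚ)) = 0 := by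
    rw [show (-((2 * ∏ i, p i : ℕ) : ℚ)) - ((2 * ∏ i, p i : ℕ) : ℚ) = -((2 : ℚ) ^ 2 * ∏ j, (p j : ℚ)) by
      push_cast; ring, padicValRat.neg, h0 2]
  have e21 : padicValRat r ((0 : ℚ) - -((2 * ∏ i, p i : ℕ) : ℚ)) = 0 := by
    rw [show (0 : ℚ) - -((2 * ∏ i, p i : ℕ) : ℚ) = (2 : ℚ) ^ 1 * ∏ j, (p j : ℚ) by push_cast; ring, h0 1]
  have e23 : padicValRat r ((0 : ℚ) - ((2 * ∏ i, p i : ℕ) : ℚ)) = 0 := by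
    rw [show (0 : ℚ) - ((2 * ∏ i, p i : ℕ) : ℚ) = -((2 : ℚ) ^ 1 * ∏ j, (p j : ℚ)) by push_cast; ring,
      padicValRat.neg, h0 1]
  constructor
  · have := W.even_padicValRat_of_mem_selmerGroup hT hc v (by rw [hrv]; exact e12) (by rw [hrv]; exact e13) a ha
    rwa [hrv] at this
  · have := W.even_padicValRat_of_mem_selmerGroup hT.swap₁₂ hc v (by rw [hrv]; exact e21)
      (by rw [hrv]; exact e23) b hb
    rwa [hrv] at this

/-- **The real place**: the first component of a Selmer class of `E_n` is positive (`e₁ = −n` is the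
smallest root). [cite: SilvermanAEC2009, Prop. X.1.4, Prop. X.4.9] -/
theorem pos_of_mem (hp : ∀ i, (p i).Prime)
    {c : galH1Torsion (congruentNumberCurve (2 * ∏ i, p i)) 2}
    (hc : c ∈ (congruentNumberCurve (2 * ∏ i, p i)).selmerGroup 2) (a : ℚˣ)
    (ha : kummerEquiv ℚ 2 ((congruentNumberCurve (2 * ∏ i, p i)).twoTorsionCharH1 hT c) =
      Additive.ofMul (QuotientGroup.mk a)) : 0 < (a : ℚ) := by
  have hN : (0 : ℚ) < ((2 * ∏ i, p i : ℕ) : ℚ) := by exact_mod_cast Nat.pos_of_ne_zero (two_mul_prod_ne_zero hp)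
  exact (congruentNumberCurve (2 * ∏ i, p i)).pos_of_mem_selmerGroup_of_lt hT (by linarith) (by linarith) hc a ha

/-- **The `I₀*` relations at `pᵢ`** for a Selmer class of `E_n` (`n = 2p₁⋯p_k`): with `ℓ = pᵢ`,
`α = v_ℓ(a)`, `β = v_ℓ(b) (mod 2)` and `A_ii = Σ_{j≠i} [(pⱼ/pᵢ) = −1]`:
`qrBit ℓ a = α·([2] + A_ii) + β·[2]`, `qrBit ℓ b = α·[−1] + β·([−1] + [2] + A_ii)` — the two relations of
`qrBit_eq_of_mem_selmerGroup_of_add` with the constants `e₂ − e₁ = n`, `(e₁ − e₂)(e₁ − e₃) = 2n²`,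
`(e₂ − e₁)(e₂ − e₃) = −n²`, `e₁ − e₂ = −n` evaluated. [cite: SilvermanAEC2009, Prop. X.1.4, Prop. X.4.9]
[cite: HeathBrown1994SelmerCongruentII, Appendix (Monsky), typescript p. 38 L24–L31] -/
theorem qrBit_rel_of_mem (hp : ∀ i, (p i).Prime) (hp2 : ∀ i, p i ≠ 2) (hinj : Function.Injective p)
    {c : galH1Torsion (congruentNumberCurve (2 * ∏ i, p i)) 2}
    (hc : c ∈ (congruentNumberCurve (2 * ∏ i, p i)).selmerGroup 2) (a b : ℚˣ)
    (ha : kummerEquiv ℚ 2 ((congruentNumberCurve (2 * ∏ i, p i)).twoTorsionCharH1 hT c) =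
      Additive.ofMul (QuotientGroup.mk a))
    (hb : kummerEquiv ℚ 2 ((congruentNumberCurve (2 * ∏ i, p i)).twoTorsionCharH1 hT.swap₁₂ c) =
      Additive.ofMul (QuotientGroup.mk b)) (i : Fin k) :
    haveI : Fact (p i).Prime := ⟨hp i⟩
    qrBit (p i) (a : ℚ) =
        parityBit (p i) (a : ℚ) * (addLegendreSym 2 (p i) + ∑ j ∈ Finset.univ.erase i, addLegendreSym (p j) (p i)) +
          parityBit (p i) (b : ℚ) * addLegendreSym 2 (p i) ∧
      qrBit (p i) (b : ℚ) =
        parityBit (p i) (a : ℚ) * addLegendreSym (-1) (p i) +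
          parityBit (p i) (b : ℚ) * (addLegendreSym (-1) (p i) + addLegendreSym 2 (p i) +
            ∑ j ∈ Finset.univ.erase i, addLegendreSym (p j) (p i)) := by
  haveI : Fact (p i).Prime := ⟨hp i⟩
  set W := congruentNumberCurve (2 * ∏ i, p i) with hW
  set v : HeightOneSpectrum (𝓞 ℚ) := primesEquiv.symm ⟨p i, hp i⟩ with hv
  have hℓv : (primesEquiv v : ℕ) = p i := by rw [hv, Equiv.apply_symm_apply]
  have hN0 : ((2 * ∏ i, p i : ℕ) : ℚ) ≠ 0 := by exact_mod_cast two_mul_prod_ne_zero hp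
  have h1 := padicValRat_two_pow_mul_prod_self hp hp2 hinj i
  have h12 : padicValRat (p i) (-((2 * ∏ i, p i : ℕ) : ℚ) - 0) = 1 := by
    rw [show -((2 * ∏ i, p i : ℕ) : ℚ) - 0 = -((2 : ℚ) ^ 1 * ∏ j, (p j : ℚ)) by push_cast; ring,
      padicValRat.neg, h1 1]
  have h13 : padicValRat (p i) (-((2 * ∏ i, p i : ℕ) : ℚ) - ((2 * ∏ i, p i : ℕ) : ℚ)) = 1 := by
    rw [show -((2 * ∏ i, p i : ℕ) : ℚ) - ((2 * ∏ i, p i : ℕ) : ℚ) = -((2 : ℚ) ^ 2 * ∏ j, (p j : ℚ)) by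
      push_cast; ring, padicValRat.neg, h1 2]
  have h23 : padicValRat (p i) ((0 : ℚ) - ((2 * ∏ i, p i : ℕ) : ℚ)) = 1 := by
    rw [show (0 : ℚ) - ((2 * ∏ i, p i : ℕ) : ℚ) = -((2 : ℚ) ^ 1 * ∏ j, (p j : ℚ)) by push_cast; ring,
      padicValRat.neg, h1 1]
  have key := W.qrBit_eq_of_mem_selmerGroup_of_add hT hc v (by rw [hℓv]; exact h12) (by rw [hℓv]; exact h13)
    (by rw [hℓv]; exact h23) a b ha hb
  simp only [hℓv] at key
  -- the constants
  have hn := qrBit_n hp hp2 hinj i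
  have k21 : qrBit (p i) ((0 : ℚ) - -((2 * ∏ i, p i : ℕ) : ℚ)) =
      addLegendreSym 2 (p i) + ∑ j ∈ Finset.univ.erase i, addLegendreSym (p j) (p i) := by
    rw [show (0 : ℚ) - -((2 * ∏ i, p i : ℕ) : ℚ) = ((2 * ∏ i, p i : ℕ) : ℚ) by ring, hn]
  have k1213 : qrBit (p i) ((-((2 * ∏ i, p i : ℕ) : ℚ) - 0) * (-((2 * ∏ i, p i : ℕ) : ℚ) - ((2 * ∏ i, p i : ℕ) : ℚ))) =
      addLegendreSym 2 (p i) := by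
    rw [show (-((2 * ∏ i, p i : ℕ) : ℚ) - 0) * (-((2 * ∏ i, p i : ℕ) : ℚ) - ((2 * ∏ i, p i : ℕ) : ℚ)) =
        (2 : ℚ) * ((2 * ∏ i, p i : ℕ) : ℚ) ^ 2 by ring, qrBit_mul (p i) two_ne_zero (pow_ne_zero 2 hN0),
      qrBit_sq, add_zero, qrBit_two_eq_addLegendreSym (hp2 i)]
  have k2123 : qrBit (p i) (((0 : ℚ) - -((2 * ∏ i, p i : ℕ) : ℚ)) * ((0 : ℚ) - ((2 * ∏ i, p i : ℕ) : ℚ))) =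
      addLegendreSym (-1) (p i) := by
    rw [show ((0 : ℚ) - -((2 * ∏ i, p i : ℕ) : ℚ)) * ((0 : ℚ) - ((2 * ∏ i, p i : ℕ) : ℚ)) =
        (-1 : ℚ) * ((2 * ∏ i, p i : ℕ) : ℚ) ^ 2 by ring, qrBit_mul (p i) (by norm_num) (pow_ne_zero 2 hN0),
      qrBit_sq, add_zero, qrBit_neg_one_eq_addLegendreSym]
  have k12 : qrBit (p i) (-((2 * ∏ i, p i : ℕ) : ℚ) - 0) =
      addLegendreSym (-1) (p i) + addLegendreSym 2 (p i) + ∑ j ∈ Finset.univ.erase i, addLegendreSym (p j) (p i) := by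
    rw [show -((2 * ∏ i, p i : ℕ) : ℚ) - 0 = (-1 : ℚ) * ((2 * ∏ i, p i : ℕ) : ℚ) by ring,
      qrBit_mul (p i) (by norm_num) hN0, qrBit_neg_one_eq_addLegendreSym, hn, add_assoc]
  rw [k21, k1213, k2123, k12] at key
  exact key

/-- **The `2`-adic relation** on a Selmer class of `E_n`, `n = 2p₁⋯p_k`:
`v₂(a) = chi4(b) + chi4(p₁⋯p_k)·v₂(b) (mod 2)`. [cite: SilvermanAEC2009, Example X.1.5, Prop. X.4.9] -/
theorem dyadic_of_mem (hp : ∀ i, (p i).Prime) (hp2 : ∀ i, p i ≠ 2)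
    {c : galH1Torsion (congruentNumberCurve (2 * ∏ i, p i)) 2}
    (hc : c ∈ (congruentNumberCurve (2 * ∏ i, p i)).selmerGroup 2) (a b : ℚˣ)
    (ha : kummerEquiv ℚ 2 ((congruentNumberCurve (2 * ∏ i, p i)).twoTorsionCharH1 hT c) =
      Additive.ofMul (QuotientGroup.mk a))
    (hb : kummerEquiv ℚ 2 ((congruentNumberCurve (2 * ∏ i, p i)).twoTorsionCharH1 hT.swap₁₂ c) =
      Additive.ofMul (QuotientGroup.mk b)) :
    parityBit 2 (a : ℚ) = chi4 (b : ℚ) + (∑ j, addLegendreSym (-1) (p j)) * parityBit 2 (b : ℚ) := by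
  have key := (congruentNumberCurve (2 * ∏ i, p i)).parityBit_two_eq_of_mem_selmerGroup_cn (odd_prod hp hp2)
    (n := ((2 * ∏ i, p i : ℕ) : ℚ)) (by push_cast; rfl) hT hc a b ha hb
  rwa [chi4_prod hp hp2] at key


end CongruentNumberEvenMonskySelmer

end Literature.NumberTheory.EllipticCurves

end
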